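import Mathlib.Analysis.Calculus.FDeriv.WithLp
import Literature.Barriers.QuantumFields.NoClassicalGlueballsConformalCurrent
import Literature.Barriers.QuantumFields.NoClassicalGlueballsSlices
import HarnessLib

/-!
# Decay of classical Yang–Mills fields: the first inversional conservation law (proofs)

Sibling proof file of `Literature/Barriers/QuantumFields/NoClassicalGlueballs.lean` (barrier
catalogue D-0021, summit `QuantumFields`), towards the named fact `GlasseyStraussLocalEnergyDecay`
(Glassey–Strauss, CMP 65 (1979), §4 Theorem). On top of the stress tensor `θ_{μν} = stressTensor B A`
with its conservation `Σ_μ η^{μμ} ∂_μ θ_{μν} = 0` (`NoClassicalGlueballsStressTensor`), the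
conformal Killing field `K = inversionField t₀` and the current `J^μ = conformalCurrent B A t₀ μ =
η^{μμ} Σ_ν θ_{μν} K^ν` (`NoClassicalGlueballsConformalCurrent`), this file proves, in the abstract
setting (any coefficient algebra `𝔸`, any `ad(𝔤)`-invariant positive form `B`, any smooth
`𝔤`-valued solution of the Yang–Mills equations on `ℝ^{1+3}`):

* the derivatives of `K`: `∂₀K⁰ = 2(x⁰−t₀)`, `∂_jK⁰ = 2xʲ`, `∂₀Kⁱ = 2xⁱ`, `∂_jKⁱ = 2(x⁰−t₀)δ_{ij}`
  (`fderiv_inversionField_*`), and that `K` is conformal Killing *against the traceless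
  symmetric `θ`*: `Σ_{μν} η^{μμ} θ_{μν} ∂_μ K^ν = 2(x⁰−t₀)(θ₀₀ − Σ_j θ_{jj}) +
  2 Σ_i xⁱ(θ_{0i} − θ_{i0}) = 0` (`sum_stressTensor_mul_fderiv_inversionField`, from
  `stressTensor_trace` and `stressTensor_symm`);
* **the first inversional identity `∂_μ J^μ = 0`** (`conformalCurrent_conservation`), Glassey–Strauss
  §3 (13): `Σ_μ ∂_μ J^μ = Σ_ν K^ν Σ_μ η^{μμ}∂_μθ_{μν} + Σ_{μν} η^{μμ}θ_{μν}∂_μK^ν = 0 + 0`;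
* its form in the chart `(t, y) = ofTimeSpace t y` (`conformalCurrent_conservation_chart`):
  `∂_t J⁰(t, y) + Σ_i ∂_{y_i} Jⁱ(t, y) = 0`, using the slice calculus of
  `NoClassicalGlueballsSlices` (`hasDerivAt_comp_ofTimeSpace`, `fderiv_comp_ofTimeSpace_single`).

Glassey–Strauss derive (13) from the energy identity (e) times `r² + t²` plus the momentum
identities (p_j) times `2t x_j` (p. 5); the present route through `θ` and the conformal Killing
equation is the same computation organised invariantly (their §1: "Since the conformal group is
15-dimensional, Noether's theorem implies that there must exist 15 independent conservation laws
… the remaining four are the inversional laws").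

## References

* R. T. Glassey, W. A. Strauss, *Decay of classical Yang–Mills fields*, Commun. Math. Phys. 65
  (1979) 1–13, §1, §3 (e), (p_j), (13) [GlasseyStrauss1979].
* S. Coleman, *There are no classical glueballs*, Commun. Math. Phys. 55 (1977) 113–116, §2 (4)–(5)
  [Coleman1977].
-/

noncomputable section

namespace Literature.Barriers.QuantumFields

open Literature.MathematicalPhysics.QuantumLattice
open scoped ContDiff

variable {𝔸 : Type*} [NormedRing 𝔸] [NormedAlgebra ℝ 𝔸]

/-! ### Derivatives of the coordinates and of the Killing field `K` -/

section Killing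

/-- The coordinate functions `y ↦ y^κ` of `ℝ^{1+3}` are differentiable, with derivative the
coordinate projection. [folklore] -/
theorem hasFDerivAt_coord (κ : Fin 4) (x : SpaceTime 3) :
    HasFDerivAt (fun y : SpaceTime 3 => y κ) (PiLp.proj (𝕜 := ℝ) 2 (fun _ : Fin 4 => ℝ) κ) x :=
  PiLp.hasFDerivAt_apply (𝕜 := ℝ) 2 x κ

/-- `∂_μ y^κ = δ_{κμ}`. [folklore] -/
@[simp]
theorem proj_unitVec (κ μ : Fin 4) :
    PiLp.proj (𝕜 := ℝ) 2 (fun _ : Fin 4 => ℝ) κ (unitVec μ) = if κ = μ then 1 else 0 := by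
  rw [PiLp.proj_apply, unitVec_apply]

/-- Derivative of a squared shifted coordinate: `d (y^κ − c)² = 2 (x^κ − c) dy^κ`. [folklore] -/
theorem hasFDerivAt_coord_sub_sq (κ : Fin 4) (c : ℝ) (x : SpaceTime 3) :
    HasFDerivAt (fun y : SpaceTime 3 => (y κ - c) ^ 2)
      ((2 * (x κ - c)) • PiLp.proj (𝕜 := ℝ) 2 (fun _ : Fin 4 => ℝ) κ) x := by
  have h := ((hasFDerivAt_coord κ x).sub_const c).mul ((hasFDerivAt_coord κ x).sub_const c)
  have e : (fun y : SpaceTime 3 => (y κ - c) ^ 2) = fun y => (y κ - c) * (y κ - c) := by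
    funext y; ring
  rw [e]
  refine h.congr_fderiv ?_
  rw [← add_smul]
  congr 1
  ring

/-- **Derivative of `K⁰`**: `dK⁰ = 2 (x⁰ − t₀) dx⁰ + Σ_i 2 xⁱ dxⁱ`. [folklore] -/
theorem hasFDerivAt_inversionField_zero (t₀ : ℝ) (x : SpaceTime 3) :
    HasFDerivAt (inversionField t₀ 0)
      ((2 * (x 0 - t₀)) • PiLp.proj (𝕜 := ℝ) 2 (fun _ : Fin 4 => ℝ) 0 +
        ∑ i : Fin 3, (2 * (x i.succ - 0)) • PiLp.proj (𝕜 := ℝ) 2 (fun _ : Fin 4 => ℝ) i.succ) x := by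
  have e : inversionField t₀ 0 =
      fun y : SpaceTime 3 => (y 0 - t₀) ^ 2 + ∑ i : Fin 3, (y i.succ - 0) ^ 2 := by
    funext y; simp [inversionField]
  rw [e]
  exact (hasFDerivAt_coord_sub_sq 0 t₀ x).add
    (HasFDerivAt.fun_sum fun i _ => hasFDerivAt_coord_sub_sq i.succ 0 x)

/-- **Derivative of `Kⁱ`**: `dKⁱ = 2 (x⁰ − t₀) dxⁱ + 2 xⁱ dx⁰`. [folklore] -/
theorem hasFDerivAt_inversionField_succ (t₀ : ℝ) (i : Fin 3) (x : SpaceTime 3) :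
    HasFDerivAt (inversionField t₀ i.succ)
      ((2 * (x 0 - t₀)) • PiLp.proj (𝕜 := ℝ) 2 (fun _ : Fin 4 => ℝ) i.succ +
        x i.succ • ((2 : ℝ) • PiLp.proj (𝕜 := ℝ) 2 (fun _ : Fin 4 => ℝ) 0)) x := by
  have e : inversionField t₀ i.succ = fun y : SpaceTime 3 => (2 * (y 0 - t₀)) * y i.succ := by
    funext y; simp [inversionField, Fin.succ_ne_zero]
  rw [e]
  exact (((hasFDerivAt_coord 0 x).sub_const t₀).const_mul 2).mul (hasFDerivAt_coord i.succ x)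

/-- `∂_μ K⁰ = 2 (x^μ − δ_{μ0} t₀)`, i.e. `∂₀ K⁰ = 2(x⁰ − t₀)`, `∂_j K⁰ = 2 xʲ`. [folklore] -/
theorem fderiv_inversionField_zero (t₀ : ℝ) (x : SpaceTime 3) (μ : Fin 4) :
    fderiv ℝ (inversionField t₀ 0) x (unitVec μ) = 2 * (x μ - if μ = 0 then t₀ else 0) := by
  rw [(hasFDerivAt_inversionField_zero t₀ x).fderiv]
  refine Fin.cases ?_ (fun j => ?_) μ
  · simp [Fin.succ_ne_zero]
  · simp [Fin.succ_ne_zero, (Fin.succ_ne_zero j).symm]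

/-- `∂₀ Kⁱ = 2 xⁱ`. [folklore] -/
theorem fderiv_inversionField_succ_zero (t₀ : ℝ) (x : SpaceTime 3) (i : Fin 3) :
    fderiv ℝ (inversionField t₀ i.succ) x (unitVec 0) = 2 * x i.succ := by
  rw [(hasFDerivAt_inversionField_succ t₀ i x).fderiv]
  simp [Fin.succ_ne_zero, mul_comm]

/-- `∂_j Kⁱ = 2 (x⁰ − t₀) δ_{ij}`. [folklore] -/
theorem fderiv_inversionField_succ_succ (t₀ : ℝ) (x : SpaceTime 3) (i j : Fin 3) :
    fderiv ℝ (inversionField t₀ i.succ) x (unitVec j.succ) = if i = j then 2 * (x 0 - t₀) else 0 := by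
  rw [(hasFDerivAt_inversionField_succ t₀ i x).fderiv]
  simp [(Fin.succ_ne_zero j).symm, Fin.succ_inj]

/-- The components of `K` are differentiable. [folklore] -/
theorem differentiableAt_inversionField (t₀ : ℝ) (ν : Fin 4) (x : SpaceTime 3) :
    DifferentiableAt ℝ (inversionField t₀ ν) x := by
  refine Fin.cases ?_ (fun i => ?_) ν
  · exact (hasFDerivAt_inversionField_zero t₀ x).differentiableAt
  · exact (hasFDerivAt_inversionField_succ t₀ i x).differentiableAt

/-- The components of `K` are smooth (polynomials). [folklore] -/
theorem contDiff_inversionField (t₀ : ℝ) (ν : Fin 4) : ContDiff ℝ ∞ (inversionField t₀ ν) := by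
  have hc : ∀ κ : Fin 4, ContDiff ℝ ∞ fun y : SpaceTime 3 => y κ := fun κ =>
    (PiLp.proj (𝕜 := ℝ) 2 (fun _ : Fin 4 => ℝ) κ).contDiff
  refine Fin.cases ?_ (fun i => ?_) ν
  · have e : inversionField t₀ 0 = fun y : SpaceTime 3 => (y 0 - t₀) ^ 2 + ∑ i : Fin 3, y i.succ ^ 2 := by
      funext y; simp [inversionField]
    rw [e]
    exact ((hc 0).sub contDiff_const).pow 2 |>.add (ContDiff.sum fun i _ => (hc i.succ).pow 2)
  · have e : inversionField t₀ i.succ = fun y : SpaceTime 3 => (2 * (y 0 - t₀)) * y i.succ := by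
      funext y; simp [inversionField, Fin.succ_ne_zero]
    rw [e]
    exact (contDiff_const.mul ((hc 0).sub contDiff_const)).mul (hc i.succ)

end Killing

/-! ### The inversional identity `∂_μ J^μ = 0` -/

section Inversional

variable {𝔤 : Submodule ℝ 𝔸} {B : 𝔸 →L[ℝ] 𝔸 →L[ℝ] ℝ} {A : Connection (SpaceTime 3) 𝔸}

/-- **`K` is conformal Killing for the traceless symmetric `θ`**:
`Σ_{μν} η^{μμ} θ_{μν} ∂_μ K^ν = 2(x⁰ − t₀)(θ₀₀ − Σ_j θ_{jj}) + 2 Σ_i xⁱ (θ_{0i} − θ_{i0}) = 0`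
by tracelessness (`stressTensor_trace`) and symmetry. [cite: GlasseyStrauss1979, §3 (13)] -/
theorem sum_stressTensor_mul_fderiv_inversionField (hB : IsInvariantForm 𝔤 B) (t₀ : ℝ)
    (x : SpaceTime 3) :
    ∑ μ, ∑ ν, metricDiag μ * stressTensor B A μ ν x *
      fderiv ℝ (inversionField t₀ ν) x (unitVec μ) = 0 := by
  have hsym : ∀ i : Fin 3, stressTensor B A i.succ 0 x = stressTensor B A 0 i.succ x := fun i =>
    stressTensor_symm hB A _ _ x
  have htr := stressTensor_trace (B := B) (A := A) x
  simp only [Fin.sum_univ_succ (n := 3), metricDiag_zero, metricDiag_succ, one_mul,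
    fderiv_inversionField_zero, fderiv_inversionField_succ_zero, fderiv_inversionField_succ_succ,
    if_true, Fin.succ_ne_zero, if_false, sub_zero, mul_ite, mul_zero, Finset.sum_ite_eq',
    Finset.mem_univ, hsym, htr]
  rw [Finset.sum_mul, ← Finset.sum_add_distrib, ← Finset.sum_add_distrib]
  exact Finset.sum_eq_zero fun i _ => by ring

/-- The inversional current is differentiable (smooth connection). [folklore] -/
theorem differentiableAt_conformalCurrent (hA : IsSmoothConnection A) (t₀ : ℝ) (μ : Fin 4)
    (x : SpaceTime 3) : DifferentiableAt ℝ (conformalCurrent B A t₀ μ) x := by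
  unfold conformalCurrent
  exact (DifferentiableAt.fun_sum fun ν _ =>
    (((contDiff_stressTensor (B := B) hA μ ν).differentiable (by simp)) x).fun_mul
      (differentiableAt_inversionField t₀ ν x)).const_mul _

/-- The inversional current of a smooth connection is smooth. [folklore] -/
theorem contDiff_conformalCurrent (hA : IsSmoothConnection A) (t₀ : ℝ) (μ : Fin 4) :
    ContDiff ℝ ∞ (conformalCurrent B A t₀ μ) := by
  unfold conformalCurrent
  exact contDiff_const.mul (ContDiff.sum fun ν _ =>
    (contDiff_stressTensor (B := B) hA μ ν).mul (contDiff_inversionField t₀ ν))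

/-- **Derivative of the inversional current**:
`∂_w J^μ = η^{μμ} Σ_ν (∂_w θ_{μν} · K^ν + θ_{μν} ∂_w K^ν)`. [folklore] -/
theorem fderiv_conformalCurrent_apply (hA : IsSmoothConnection A) (t₀ : ℝ) (μ : Fin 4)
    (x w : SpaceTime 3) :
    fderiv ℝ (conformalCurrent B A t₀ μ) x w =
      metricDiag μ * ∑ ν, (fderiv ℝ (stressTensor B A μ ν) x w * inversionField t₀ ν x +
        stressTensor B A μ ν x * fderiv ℝ (inversionField t₀ ν) x w) := by
  have hθ : ∀ ν, DifferentiableAt ℝ (stressTensor B A μ ν) x := fun ν =>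
    ((contDiff_stressTensor (B := B) hA μ ν).differentiable (by simp)) x
  have hK := differentiableAt_inversionField t₀
  unfold conformalCurrent
  rw [fderiv_const_mul (DifferentiableAt.fun_sum fun ν _ => (hθ ν).fun_mul (hK ν x)),
    smul_apply, smul_eq_mul, fderiv_fun_sum fun ν _ => (hθ ν).fun_mul (hK ν x), sum_apply]
  congr 1
  refine Finset.sum_congr rfl fun ν _ => ?_
  rw [fderiv_fun_mul (hθ ν) (hK ν x), add_apply, smul_apply, smul_apply, smul_eq_mul, smul_eq_mul]
  ring

/-- **The first inversional conservation law `∂_μ J^μ = 0` (Glassey–Strauss (13))** for smooth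
`𝔤`-valued solutions of the Yang–Mills equations and an `ad(𝔤)`-invariant form: with
`J^μ = η^{μμ} Σ_ν θ_{μν} K^ν`, `Σ_μ ∂_μ J^μ = Σ_ν K^ν (Σ_μ η^{μμ} ∂_μ θ_{μν}) +
Σ_{μν} η^{μμ} θ_{μν} ∂_μ K^ν = 0 + 0` (energy–momentum conservation, and `K` conformal Killing
against the traceless symmetric `θ`). [cite: GlasseyStrauss1979, §3 (13)] -/
theorem conformalCurrent_conservation (hB : IsInvariantForm 𝔤 B) (h𝔤 : A.IsValuedIn 𝔤)
    (hA : IsSmoothConnection A) (hsol : IsMinkowskiYangMills A) (t₀ : ℝ) (x : SpaceTime 3) :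
    ∑ μ, fderiv ℝ (conformalCurrent B A t₀ μ) x (unitVec μ) = 0 := by
  simp only [fderiv_conformalCurrent_apply hA, Finset.mul_sum, mul_add, Finset.sum_add_distrib]
  have h1 : ∑ μ, ∑ ν, metricDiag μ * (fderiv ℝ (stressTensor B A μ ν) x (unitVec μ) *
      inversionField t₀ ν x) = 0 := by
    rw [Finset.sum_comm]
    refine Finset.sum_eq_zero fun ν _ => ?_
    have h := stressTensor_conservation hB h𝔤 hA hsol ν x
    calc ∑ μ, metricDiag μ * (fderiv ℝ (stressTensor B A μ ν) x (unitVec μ) * inversionField t₀ ν x)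
        = (∑ μ, metricDiag μ * fderiv ℝ (stressTensor B A μ ν) x (unitVec μ)) *
            inversionField t₀ ν x := by
          rw [Finset.sum_mul]
          exact Finset.sum_congr rfl fun μ _ => by ring
      _ = 0 := by rw [h, zero_mul]
  have h2 := sum_stressTensor_mul_fderiv_inversionField (A := A) hB t₀ x
  rw [h1, zero_add]
  simpa only [mul_assoc] using h2

/-! ### The inversional law in the chart -/

/-- **The inversional law (13) in the chart `(t, y)`**:
`∂_t J⁰(t, y) + Σ_i ∂_{y_i} Jⁱ(t, y) = 0`, the partial derivatives being those of
`s ↦ J⁰(ofTimeSpace s y)` and `y ↦ Jⁱ(ofTimeSpace t y)`. [cite: GlasseyStrauss1979, §3 (13)] -/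
theorem conformalCurrent_conservation_chart (hB : IsInvariantForm 𝔤 B) (h𝔤 : A.IsValuedIn 𝔤)
    (hA : IsSmoothConnection A) (hsol : IsMinkowskiYangMills A) (t₀ t : ℝ)
    (y : EuclideanSpace ℝ (Fin 3)) :
    deriv (fun s : ℝ => conformalCurrent B A t₀ 0 (ofTimeSpace s y)) t +
      ∑ i : Fin 3, fderiv ℝ (fun y' : EuclideanSpace ℝ (Fin 3) =>
        conformalCurrent B A t₀ i.succ (ofTimeSpace t y')) y (EuclideanSpace.single i 1) = 0 := by
  have hd := differentiableAt_conformalCurrent (B := B) hA t₀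
  rw [(hasDerivAt_comp_ofTimeSpace t y (hd 0 _)).deriv]
  simp only [fderiv_comp_ofTimeSpace_single t y (hd _ _)]
  have h := conformalCurrent_conservation hB h𝔤 hA hsol t₀ (ofTimeSpace t y)
  rwa [Fin.sum_univ_succ] at h

end Inversional

end Literature.Barriers.QuantumFields
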